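import Summits.QuantumFields.YangMills.Theses.DoublingDefect

/-!
# Crux-ideate sketch (ideator 2, round 1) — stmt-QuantumFields-18927 `GapAtCorrelationLength` (W₁)

Idea `af-monotone-exit`: reach DoublingDefect's EXIT SCALE `L*(β)` (the first torus side at which the
aspect-≤2 thermal state is ε-pure) by MONOTONE GROWTH of the purity
`π_β(L) := Z_β(L,L,L,2L) / Z_β(L,L,L,L)²` under volume doubling, starting from the femto-universe, and close
the (R2-restated, local-algebra) W₁ at the exit scale with `a_k := 1/L*(β_k)`.

The doubling map `π_β(L) ↦ π_β(2L)` is cut into three regimes, each a stub with its own character: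

* `ToronDegeneracy` (TD, provable-grade, finite-dimensional): at FIXED lattice size the purity tends to
  `0` as `β → ∞` (flat connections mod gauge form a continuum ⊇ T^4/W: `π ≍ β^{-3 rk G/2}`).  Uses the
  CONTINUITY of `G` (fails for finite `G`: isolated flat vacua, `π → 1/N_flat`).  Gives `L*(β) → ∞`.
* `FemtoGrowth` (AF, constructive-UV grade): while the purity is small (femto-universe, `L ≪ ξ`) it grows
  under doubling by a factor `1 + φ(π) − A/L²`, `φ > 0` — the sign of the one-loop torus β-function
  (Lüscher 1983, Lüscher–Münster 1984, Koller–van Baal 1986: `π ≍ g_R(L)^{3rk}`, `g_R(2L) > g_R(L)`), up to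
  `O(1/L²)` cutoff artefacts (summable along the dyadic chain, hence harmless).  Uses that `G` is NON-ABELIAN
  (fails for `U(1)₄`: photon/flux gas, `π_β(2L) = π_β(L)` at every `L`).
* `CrossoverGrowth` (CROSS, the residual kernel): uniform strict growth `π(2L) ≥ π(L) + θ₀` across the
  crossover window `π ∈ [π_lo, 1 − ε]` — qualitative, finite physical volume (`L ≤ L*`), no rate.

`monotoneExit_of_growth` (PROVED below, real analysis only) composes them into `MonotoneExit`: one exit
scale per large `β`, and no bounded family of sizes is ever an exit scale for large `β` (`L* → ∞`).
With `DoublingDefect.DoublingRecursion` (stmt-QuantumFields-17754) and `DoublingDefect.RecursionToGap`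
(stmt-QuantumFields-17755) this yields the volume-uniform local gap `m(β) ≍ 1/L*(β)`; the tracking scheme
`β_k := k`, `a_k := 1/L*(β_k)`, `L_k := ⌈L*^{1+1/N}⌉` and RP log-convexity + a certified perturbative window
(route XiCompleteMonotonicity / crux TunedSequenceExists tools) give floor and window — i.e. the LOCAL
form `Strategist.OneScaleRPCoreLoc` of W₁ (STRATEGY-CENSUS §1 R2).  The crux AS TYPED (global slab
functionals) stays refuted for `π₁(G) ≠ 1` by `Strategist.gapAtCorrelationLength_false_of_lightFlux`;
nothing here touches that.
-/

noncomputable section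

open scoped BigOperators Topology
open MeasureTheory Filter Set Function
open Literature.MathematicalPhysics.QuantumLattice Literature.MathematicalPhysics.AQFT
open Literature.MathematicalPhysics.QuantumFieldTheory

namespace Summit.QuantumFields.YangMills.Cruxes.GapAtCorrelationLength.StepScaling

section Defs

variable {G : Type} [Group G] [TopologicalSpace G] [IsTopologicalGroup G] [CompactSpace G]
  [MeasurableSpace G] [BorelSpace G]

/-- Wilson partition function of the faithful representation `r` on the anisotropic torus
`(ℤ/a)³ × (ℤ/t)` — VERBATIM the inline `Z` of route DoublingDefect (OneTorusExit / DoublingRecursion /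
RecursionToGap), so that every statement below is about the same numbers. [folklore] -/
def Zat (r : LatticeRep G) (β : ℝ) (a t : ℕ) : ℝ :=
  let St := Fin a × Fin a × Fin a × Fin t
  let sh : St → Fin 4 → St := fun x μ =>
    ![(finRotate a x.1, x.2.1, x.2.2.1, x.2.2.2), (x.1, finRotate a x.2.1, x.2.2.1, x.2.2.2),
      (x.1, x.2.1, finRotate a x.2.2.1, x.2.2.2), (x.1, x.2.1, x.2.2.1, finRotate t x.2.2.2)] μ
  let pl : (St × Fin 4 → G) → St → Fin 4 → Fin 4 → G := fun U x μ ν =>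
    U (x, μ) * U (sh x μ, ν) * (U (sh x ν, μ))⁻¹ * (U (x, ν))⁻¹
  ∫ U, Real.exp (-β * ∑ x : St, ∑ q : {q : Fin 4 × Fin 4 // q.1 < q.2},
      ((r.N : ℝ) - (r.ρ (pl U x q.1.1 q.1.2)).trace.re))
    ∂(Measure.pi fun _ : St × Fin 4 => haarProbability G)

/-- **Purity** of the aspect-≤2 thermal state, `π_β(L) = Tr ρ_L² = Z_β(L,2L)/Z_β(L,L)²`
(Lüscher's transfer matrix, `ρ_L = T_L^L / Tr T_L^L`); DoublingDefect's defect is `δ = 1 − π`.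
The dimensionless gap variable of the card is `−log(1 − π)`; small `π` = femto regime (many thermally
populated toron levels), `π` near `1` = vacuum dominance (exit). [folklore] -/
def purity (r : LatticeRep G) (β : ℝ) (L : ℕ) : ℝ := Zat r β L (2 * L) / (Zat r β L L) ^ 2

/-- DoublingDefect's purity DEFECT `δ_β(L) = 1 − Z_β(L,2L)/Z_β(L,L)²`. [folklore] -/
def defect (r : LatticeRep G) (β : ℝ) (L : ℕ) : ℝ := 1 - purity r β L

end Defs

/-! ## The three regime stubs of the doubling map and the bookkeeping hypothesis -/

/-- Bookkeeping (provable now: the integrand of `Zat` is a positive continuous function, the measure a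
probability measure): the purity is positive. [folklore] -/
def PurityPos : Prop :=
  ∀ (G : Type) [Group G] [TopologicalSpace G] [IsTopologicalGroup G] [CompactSpace G]
    [MeasurableSpace G] [BorelSpace G],
    IsCompactSimpleLieGroup G → SimplyConnectedSpace G →
      ∀ (r : LatticeRep G) (β : ℝ) (L : ℕ), 0 < purity r β L

/-- **(TD) TORON DEGENERACY** — the stub that uses the CONTINUITY of `G`.  At fixed lattice size the
purity of the aspect-2 thermal state tends to `0` as `β → ∞`: both partition functions are Laplace
integrals concentrating on the variety of FLAT connections, whose generic (toral) stratum has dimension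
`(#links)·dim G + 3·rk G`, so `Z_β(a,t) ≍ c(a,t) β^{−(3a³t·dim G − 3 rk G)/2}` and
`π_β(L) ≍ β^{−3 rk G/2} → 0` (for `SU(N)` every flat connection is toral; singular strata = Koller–van Baal's
quartic modes and, for `Spin(n ≥ 7)`/exceptional `G`, non-toral commuting triples are the technical
content).  FALSE for finite `G` (isolated vacua: `π → 1/N_flat > 0`) — this is where DiscreteSubgroupFreezing
is honoured.  Consequence used: the exit scale `L*(β) → ∞`, i.e. `a_k → 0`. [folklore] -/
def ToronDegeneracy : Prop :=
  ∀ (G : Type) [Group G] [TopologicalSpace G] [IsTopologicalGroup G] [CompactSpace G]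
    [MeasurableSpace G] [BorelSpace G],
    IsCompactSimpleLieGroup G → SimplyConnectedSpace G →
      ∀ (r : LatticeRep G) (L : ℕ), 2 ≤ L → Tendsto (fun β : ℝ => purity r β L) atTop (𝓝 0)

/-- **(AF) FEMTO GROWTH** — the stub that uses that `G` is NON-ABELIAN.  There is a threshold `p_AF > 0`,
a continuous `φ > 0` on `(0, p_AF]` and an artefact constant `A ≥ 0` such that, at all large `β` and sizes
`L ≥ L₀`, a purity `≤ p_AF` grows under doubling at least by the factor `1 + φ(π) − A/L²`.  Mechanism:
`π ≤ p_AF` is the femto-universe `L ≪ ξ(β)`, where `π_β(L) = C(L)·P(g_R(L))·(1 + O(g_R²))`, `P(g) ≍ g^{3 rk G}`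
increasing (classical limit of Lüscher's effective Hamiltonian on the toron valley ⟺ more populated levels;
Koller–van Baal: "absence of infrared divergences"), and `g_R(2L)² = g_R(L)²(1 + 2b₀ log 2·g_R(L)² + …)` with
`b₀ > 0`; so `φ(π) ≍ 3 rk G · b₀ log 2 · g_R(π)²`.  The artefact allowance `A/L²` is NOT cosmetic: at FIXED `L`
and `β → ∞` the asymptotic-freedom increment dies like `1/β` while the cutoff artefact `C(2L)/C(L) − 1 = O(1/L²)`
of the lattice one-loop valley potential persists with no preferred sign — without it the stub would be false in
that corner; the composition below shows that artefacts summable along the dyadic chain cost nothing.  FALSE for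
`U(1)₄` (`b₀ = 0`: the photon/flux gas has `π_β(L) ≈ c·e³` for ALL `L`, no growth at any `L`) — this is where
AbelianDeconfinementD4 / MigdalKadanoffGroupBlindness are honoured.  Rigour needed: Bałaban's small/large-field
RG in FINITE physical volume (`L ≪ ξ`) + finite-dimensional semiclassics of the toron valley + Symanzik-type
`O(1/L²)` artefact bounds for the valley potential (constructive-UV grade, XL). [folklore] -/
def FemtoGrowth : Prop :=
  ∀ (G : Type) [Group G] [TopologicalSpace G] [IsTopologicalGroup G] [CompactSpace G]
    [MeasurableSpace G] [BorelSpace G],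
    IsCompactSimpleLieGroup G → SimplyConnectedSpace G →
      ∀ (r : LatticeRep G), ∃ (pAF : ℝ) (φ : ℝ → ℝ) (β₀ A : ℝ) (L₀ : ℕ),
        0 < pAF ∧ (∀ x : ℝ, 0 < x → x ≤ pAF → 0 < φ x) ∧ ContinuousOn φ (Set.Ioc 0 pAF) ∧ 0 ≤ A ∧
        ∀ β : ℝ, β₀ ≤ β → ∀ L : ℕ, L₀ ≤ L → purity r β L ≤ pAF →
          purity r β L * (1 + φ (purity r β L) - A / (L : ℝ) ^ 2) ≤ purity r β (2 * L)

/-- **(CROSS) CROSSOVER GROWTH** — the residual KERNEL.  Across every crossover window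
`π ∈ [p_lo, 1 − ε]` the purity grows under doubling by a uniform amount `θ > 0` (all large `β`, all
`L ≥ L₀`).  Qualitative (any `θ > 0` will do: the iteration loses only a `k`-independent constant), local in
scale (ONE doubling), and confined to finite physical volume `L ≤ L*(β) ≍ ξ(β)` — it is the non-perturbative
crossover ("Yang–Mills in a box of a few fm") and nothing beyond it.  Physically `π` is strictly increasing
in `L` (the finite-volume energies `E_i(L)·L` of pure `SU(N)` rise monotonically through van Baal's
intermediate volumes); rigorously open. [folklore] -/
def CrossoverGrowth : Prop :=
  ∀ (G : Type) [Group G] [TopologicalSpace G] [IsTopologicalGroup G] [CompactSpace G]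
    [MeasurableSpace G] [BorelSpace G],
    IsCompactSimpleLieGroup G → SimplyConnectedSpace G →
      ∀ (r : LatticeRep G) (plo ε : ℝ), 0 < plo → 0 < ε →
        ∃ (θ β₀ : ℝ) (L₀ : ℕ), 0 < θ ∧
          ∀ β : ℝ, β₀ ≤ β → ∀ L : ℕ, L₀ ≤ L → plo ≤ purity r β L → purity r β L ≤ 1 - ε →
            purity r β L + θ ≤ purity r β (2 * L)

/-- **TARGET of the growth half — MONOTONE EXIT with diverging exit scale.**  For every `ε ∈ (0,1)`:
(i) at every large `β` SOME torus side `L` has defect `δ_β(L) ≤ ε` (an exit scale exists — with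
`DoublingDefect.DoublingRecursion` this is `DoublingDefect.OneTorusExit`, arbitrarily large exits following
by iterating the recursion from `ε ≤ 1/(2C)`); (ii) no bounded range of sides `2 ≤ L ≤ L̄` contains an exit
scale once `β` is large (`L*(β) → ∞`: the lattice spacing `a_k := 1/L*(β_k)` of the W₁ scheme tends to
`0`). [folklore] -/
def MonotoneExit : Prop :=
  ∀ (G : Type) [Group G] [TopologicalSpace G] [IsTopologicalGroup G] [CompactSpace G]
    [MeasurableSpace G] [BorelSpace G],
    IsCompactSimpleLieGroup G → SimplyConnectedSpace G →
      ∀ (r : LatticeRep G) (ε : ℝ), 0 < ε → ε < 1 →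
        (∃ β₁ : ℝ, ∀ β : ℝ, β₁ ≤ β → ∃ L : ℕ, 2 ≤ L ∧ defect r β L ≤ ε) ∧
        (∀ Lbar : ℕ, ∃ β₂ : ℝ, ∀ β : ℝ, β₂ ≤ β → ∀ L : ℕ, 2 ≤ L → L ≤ Lbar → ε < defect r β L)

/-! ## The composition (real analysis only): TD ∧ AF ∧ CROSS ⇒ monotone exit -/

/-- **FIRST LEMMA of the line (kernel-checked composition).**  Positivity of the purity, toron
degeneracy, femto growth (up to `O(1/L²)` artefacts) and crossover growth imply the monotone exit.  Proof: start
the dyadic chain `L_j = 2^j L₁` at a fixed size `L₁` beyond all thresholds with `A/L₁² ≤ 3/8`; TD puts `π_β(L₁)`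
below the femto threshold for large `β`; if the chain never exits then (1) it never loses more than the summable
artefacts: `π_j ≥ π_0·(1 − (4/3)c + (4/3)c/4^j) ≥ π_0/2`, `c = A/L₁²` (exact telescoping of the allowance);
(2) from the first `j₀` with `c/4^{j₀} < φ_min/2` on (compactness of `[π_0/2, p_AF]`) it gains a uniform
`η = min(π_0 φ_min/4, θ) > 0` per doubling; a bounded chain cannot do that.  Clause (ii) is TD on finitely many
sizes. [folklore] -/
theorem monotoneExit_of_growth (hpos : PurityPos) (hTD : ToronDegeneracy) (hAF : FemtoGrowth)
    (hX : CrossoverGrowth) : MonotoneExit := by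
  intro G _ _ _ _ _ _ hG hsc r ε hε hε1
  refine ⟨?_, ?_⟩
  · -- (i) an exit scale at every large β
    obtain ⟨pAF, φ, β₀, A, L₀, hpAF, hφpos, hφcont, hA, hgrow⟩ := hAF G hG hsc r
    obtain ⟨θ, β₀', L₀', hθ, hcross⟩ := hX G hG hsc r pAF ε hpAF hε
    -- starting size: beyond both thresholds, at least 2, and so large that the artefacts are summably small
    set L₁ : ℕ := max (max 2 (max L₀ L₀')) (⌈A⌉₊ + 2) with hL₁_def
    have hL₁2 : 2 ≤ L₁ := (le_max_left _ _).trans (le_max_left _ _)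
    have hL₁0 : L₀ ≤ L₁ := ((le_max_left _ _).trans (le_max_right _ _)).trans (le_max_left _ _)
    have hL₁0' : L₀' ≤ L₁ := ((le_max_right _ _).trans (le_max_right _ _)).trans (le_max_left _ _)
    have hL₁A : A + 2 ≤ (L₁ : ℝ) := by
      have h1 : (⌈A⌉₊ + 2 : ℕ) ≤ L₁ := le_max_right _ _
      have h2 : A ≤ (⌈A⌉₊ : ℝ) := Nat.le_ceil A
      have h3 : ((⌈A⌉₊ + 2 : ℕ) : ℝ) ≤ (L₁ : ℝ) := by exact_mod_cast h1
      push_cast at h3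
      linarith
    have hL₁pos : (0 : ℝ) < L₁ := by linarith
    have hL₁ne : (L₁ : ℝ) ≠ 0 := ne_of_gt hL₁pos
    set c : ℝ := A / (L₁ : ℝ) ^ 2 with hc_def
    have hc0 : 0 ≤ c := div_nonneg hA (sq_nonneg _)
    have hc : c ≤ 3 / 8 := by
      rw [hc_def, div_le_iff₀ (by positivity)]
      have hsq : (A + 2) ^ 2 ≤ (L₁ : ℝ) ^ 2 := pow_le_pow_left₀ (by linarith) hL₁A 2
      nlinarith [hsq, sq_nonneg A]
    -- the artefact along the dyadic chain
    have hart : ∀ j : ℕ, A / (((2 ^ j * L₁ : ℕ) : ℝ)) ^ 2 = c / 4 ^ j := by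
      intro j
      have h4 : (4 : ℝ) ^ j = (2 : ℝ) ^ j * 2 ^ j := by rw [← mul_pow]; norm_num
      rw [hc_def, h4]
      push_cast
      field_simp
    have hxj : ∀ j : ℕ, 0 ≤ c / 4 ^ j ∧ c / 4 ^ j ≤ c := fun j =>
      ⟨by positivity, div_le_self hc0 (one_le_pow₀ (by norm_num))⟩
    -- TD at the starting size
    obtain ⟨β₁, hβ₁⟩ := eventually_atTop.1 ((hTD G hG hsc r L₁ hL₁2).eventually (eventually_lt_nhds hpAF))
    refine ⟨max β₁ (max β₀ β₀'), fun β hβ => ?_⟩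
    have hββ₁ : β₁ ≤ β := (le_max_left _ _).trans hβ
    have hββ₀ : β₀ ≤ β := ((le_max_left _ _).trans (le_max_right _ _)).trans hβ
    have hββ₀' : β₀' ≤ β := ((le_max_right _ _).trans (le_max_right _ _)).trans hβ
    by_contra hne
    push Not at hne
    -- hne : ∀ L, 2 ≤ L → ε < defect r β L, i.e. the chain never exits
    have hLj : ∀ j : ℕ, L₁ ≤ 2 ^ j * L₁ := fun j => by
      simpa using Nat.mul_le_mul_right L₁ (Nat.one_le_two_pow (n := j))
    have hstep : ∀ j : ℕ, 2 ^ (j + 1) * L₁ = 2 * (2 ^ j * L₁) := fun j => by ring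
    have hlt : ∀ j : ℕ, purity r β (2 ^ j * L₁) < 1 - ε := by
      intro j
      have := hne (2 ^ j * L₁) (hL₁2.trans (hLj j))
      simp only [defect] at this
      linarith
    have hPpos : ∀ j : ℕ, 0 < purity r β (2 ^ j * L₁) := fun j => hpos G hG hsc r β _
    have hp0 : 0 < purity r β L₁ := hpos G hG hsc r β L₁
    have hp0AF : purity r β L₁ < pAF := hβ₁ β hββ₁
    -- one doubling, in the two regimes (under the no-exit assumption)
    have hfemto : ∀ j : ℕ, purity r β (2 ^ j * L₁) ≤ pAF →
        purity r β (2 ^ j * L₁) * (1 + φ (purity r β (2 ^ j * L₁)) - c / 4 ^ j) ≤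
          purity r β (2 ^ (j + 1) * L₁) := by
      intro j hcase
      have hg := hgrow β hββ₀ (2 ^ j * L₁) (hL₁0.trans (hLj j)) hcase
      rw [hart j] at hg
      rwa [hstep j]
    have hcrossj : ∀ j : ℕ, pAF < purity r β (2 ^ j * L₁) →
        purity r β (2 ^ j * L₁) + θ ≤ purity r β (2 ^ (j + 1) * L₁) := by
      intro j hcase
      rw [hstep j]
      exact hcross β hββ₀' (2 ^ j * L₁) (hL₁0'.trans (hLj j)) hcase.le (hlt j).le
    -- (1) the chain never loses more than the summable artefacts
    have hQ : ∀ j : ℕ, purity r β L₁ * (1 - 4 / 3 * c + 4 / 3 * (c / 4 ^ j)) ≤ purity r β (2 ^ j * L₁) := by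
      intro j
      induction j with
      | zero =>
        have : purity r β L₁ * (1 - 4 / 3 * c + 4 / 3 * (c / 4 ^ 0)) = purity r β L₁ := by ring
        rw [this]
        simp
      | succ j ih =>
        have hKsucc : (1 - 4 / 3 * c + 4 / 3 * (c / 4 ^ (j + 1)) : ℝ) =
            (1 - 4 / 3 * c + 4 / 3 * (c / 4 ^ j)) - c / 4 ^ j := by
          rw [pow_succ]
          field_simp
          ring
        have hKle : (1 - 4 / 3 * c + 4 / 3 * (c / 4 ^ j) : ℝ) ≤ 1 := by nlinarith [(hxj j).2, hc0]
        rw [hKsucc]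
        by_cases hcase : purity r β (2 ^ j * L₁) ≤ pAF
        · have hg := hfemto j hcase
          have hφP : 0 < φ (purity r β (2 ^ j * L₁)) := hφpos _ (hPpos j) hcase
          have hx1 : c / 4 ^ j ≤ 1 := ((hxj j).2.trans hc).trans (by norm_num)
          calc purity r β L₁ * (1 - 4 / 3 * c + 4 / 3 * (c / 4 ^ j) - c / 4 ^ j)
              ≤ purity r β L₁ * ((1 - 4 / 3 * c + 4 / 3 * (c / 4 ^ j)) * (1 - c / 4 ^ j)) := by
                apply mul_le_mul_of_nonneg_left _ hp0.le
                nlinarith [mul_nonneg (sub_nonneg.2 hKle) (hxj j).1]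
            _ = (purity r β L₁ * (1 - 4 / 3 * c + 4 / 3 * (c / 4 ^ j))) * (1 - c / 4 ^ j) := by ring
            _ ≤ purity r β (2 ^ j * L₁) * (1 - c / 4 ^ j) :=
                mul_le_mul_of_nonneg_right ih (by linarith)
            _ ≤ purity r β (2 ^ j * L₁) * (1 + φ (purity r β (2 ^ j * L₁)) - c / 4 ^ j) := by
                apply mul_le_mul_of_nonneg_left _ (hPpos j).le
                linarith
            _ ≤ purity r β (2 ^ (j + 1) * L₁) := hg
        · push Not at hcase
          have hc' := hcrossj j hcase
          calc purity r β L₁ * (1 - 4 / 3 * c + 4 / 3 * (c / 4 ^ j) - c / 4 ^ j)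
              ≤ purity r β L₁ * (1 - 4 / 3 * c + 4 / 3 * (c / 4 ^ j)) := by
                apply mul_le_mul_of_nonneg_left _ hp0.le
                linarith [(hxj j).1]
            _ ≤ purity r β (2 ^ j * L₁) := ih
            _ ≤ purity r β (2 ^ (j + 1) * L₁) := by linarith
    have hlow : ∀ j : ℕ, purity r β L₁ / 2 ≤ purity r β (2 ^ j * L₁) := by
      intro j
      have h1 := hQ j
      have h2 : (1 : ℝ) / 2 ≤ 1 - 4 / 3 * c + 4 / 3 * (c / 4 ^ j) := by nlinarith [(hxj j).1, hc]
      have h3 : purity r β L₁ * (1 / 2) ≤ purity r β L₁ * (1 - 4 / 3 * c + 4 / 3 * (c / 4 ^ j)) :=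
        mul_le_mul_of_nonneg_left h2 hp0.le
      linarith
    -- (2) uniform femto factor on the compact range [π₀/2, p_AF]
    have hp2 : 0 < purity r β L₁ / 2 := half_pos hp0
    obtain ⟨x₀, hx₀mem, hx₀min⟩ : ∃ x₀ ∈ Set.Icc (purity r β L₁ / 2) pAF,
        IsMinOn φ (Set.Icc (purity r β L₁ / 2) pAF) x₀ :=
      isCompact_Icc.exists_isMinOn ⟨purity r β L₁ / 2, le_rfl, by linarith⟩
        (hφcont.mono fun x hx => ⟨hp2.trans_le hx.1, hx.2⟩)
    have hφmin : 0 < φ x₀ := hφpos x₀ (hp2.trans_le hx₀mem.1) hx₀mem.2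
    -- the artefacts die along the chain: from j₀ on they are below half the femto increment
    have h4 : Tendsto (fun n : ℕ => c / (4 : ℝ) ^ n) atTop (𝓝 0) := by
      have h := (tendsto_pow_atTop_nhds_zero_of_lt_one (show (0 : ℝ) ≤ 1 / 4 by norm_num)
        (show (1 : ℝ) / 4 < 1 by norm_num)).const_mul c
      rw [mul_zero] at h
      refine h.congr' (Eventually.of_forall fun n => ?_)
      rw [one_div_pow, mul_one_div]
    obtain ⟨j₀, hj₀⟩ := eventually_atTop.1 (h4.eventually (eventually_lt_nhds (half_pos hφmin)))
    set η : ℝ := min (purity r β L₁ / 2 * (φ x₀ / 2)) θ with hη_def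
    have hη : 0 < η := lt_min (mul_pos hp2 (half_pos hφmin)) hθ
    have hchain : ∀ n : ℕ, purity r β (2 ^ j₀ * L₁) + n * η ≤ purity r β (2 ^ (j₀ + n) * L₁) := by
      intro n
      induction n with
      | zero => simp
      | succ n ih =>
        have hgain : purity r β (2 ^ (j₀ + n) * L₁) + η ≤ purity r β (2 ^ (j₀ + n + 1) * L₁) := by
          by_cases hcase : purity r β (2 ^ (j₀ + n) * L₁) ≤ pAF
          · have hg := hfemto (j₀ + n) hcase
            have hφj : φ x₀ ≤ φ (purity r β (2 ^ (j₀ + n) * L₁)) := hx₀min ⟨hlow _, hcase⟩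
            have hcj : c / 4 ^ (j₀ + n) < φ x₀ / 2 := hj₀ (j₀ + n) (Nat.le_add_right _ _)
            have h1 : purity r β (2 ^ (j₀ + n) * L₁) * (φ x₀ / 2) ≤
                purity r β (2 ^ (j₀ + n) * L₁) * (φ (purity r β (2 ^ (j₀ + n) * L₁)) - c / 4 ^ (j₀ + n)) :=
              mul_le_mul_of_nonneg_left (by linarith) (hPpos _).le
            have h2 : purity r β L₁ / 2 * (φ x₀ / 2) ≤ purity r β (2 ^ (j₀ + n) * L₁) * (φ x₀ / 2) :=
              mul_le_mul_of_nonneg_right (hlow _) (by linarith)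
            have hηle : η ≤ purity r β L₁ / 2 * (φ x₀ / 2) := min_le_left _ _
            have hg' : purity r β (2 ^ (j₀ + n) * L₁) +
                purity r β (2 ^ (j₀ + n) * L₁) * (φ (purity r β (2 ^ (j₀ + n) * L₁)) - c / 4 ^ (j₀ + n)) ≤
                  purity r β (2 ^ (j₀ + n + 1) * L₁) := by
              have : purity r β (2 ^ (j₀ + n) * L₁) * (1 + φ (purity r β (2 ^ (j₀ + n) * L₁)) - c / 4 ^ (j₀ + n))
                  = purity r β (2 ^ (j₀ + n) * L₁) + purity r β (2 ^ (j₀ + n) * L₁) *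
                    (φ (purity r β (2 ^ (j₀ + n) * L₁)) - c / 4 ^ (j₀ + n)) := by ring
              linarith [hg, this]
            linarith
          · push Not at hcase
            have hc' := hcrossj (j₀ + n) hcase
            have hηle : η ≤ θ := min_le_right _ _
            linarith
        have hsplit : ((n : ℝ) + 1) * η = (n : ℝ) * η + η := by ring
        have hidx : j₀ + (n + 1) = j₀ + n + 1 := by ring
        rw [hidx]
        push_cast
        linarith
    -- Archimedes: the bounded chain cannot gain η forever
    obtain ⟨n, hn⟩ := exists_nat_gt (1 / η)
    have hnη : 1 < (n : ℝ) * η := by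
      have := (div_lt_iff₀ hη).1 hn
      linarith
    have h1 := hchain n
    have h2 := hlt (j₀ + n)
    have h3 := (hPpos j₀).le
    linarith
  · -- (ii) no bounded range of sizes contains an exit scale for large β (TD on finitely many sizes)
    intro Lbar
    have hε1' : (0 : ℝ) < 1 - ε := by linarith
    have hev : ∀ L ∈ Finset.Icc 2 Lbar, ∀ᶠ β : ℝ in atTop, purity r β L < 1 - ε := by
      intro L hL
      exact (hTD G hG hsc r L (Finset.mem_Icc.1 hL).1).eventually (eventually_lt_nhds hε1')
    obtain ⟨β₂, hβ₂⟩ := eventually_atTop.1 ((Filter.eventually_all_finset (Finset.Icc 2 Lbar)).2 hev)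
    refine ⟨β₂, fun β hβ L hL2 hLb => ?_⟩
    have := hβ₂ β hβ L (Finset.mem_Icc.2 ⟨hL2, hLb⟩)
    simp only [defect]
    linarith

/-! ## β-form of the kernel (addendum, same session): the bare step and the Casimir action sign

Exact identity (calculus on `Z_t = Σ_i e^{−tE_i(β)}`; provable from smoothness and positivity of `Zat`):
`D_β(L) := β·(⟨S⟩_{L³×2L} − 2⟨S⟩_{L⁴}) = −β ∂_β log π_β(L) = −2Lβ ∫_L^{2L} Cov_{p(t)}(E, ∂_βE) dt`,
`p(t) ∝ e^{−tE}` the thermal weights of the cube's transfer matrix.  So the doubling increment of CROSS can be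
traded, across ONE CUTOFF HALVING `(β, L) ↦ (β + Δ(β), 2L)`, for (a) the bare step `Δ(β) ≥ d₀ > 0`
(asymptotic freedom at the CUTOFF scale — its most ultraviolet, most perturbative placement; `Δ → 4N b₀ log 2`)
together with universality of the purity under that halving (the Symanzik `(a/ℓ)²` wall: after one exact blocking
the `(β+Δ, a/2)` theory is Wilson(β) plus an irrelevant dimension-≥6 remainder, and the claim is insensitivity of
the purity — a bulk-cancelled Casimir free-energy difference — to that remainder; the SAME wall as
`ScalingWindowSplit.CurvatureAmnesia`), and (b) strict decrease of the purity in `β` across the bare step inside the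
window: the colder/longer torus carries MORE action density ("the condensate grows when the box cools"), by a
canonical amount.  `crossoverGrowth_of_betaForm` is the (proved) bookkeeping. -/

/-- **(U_Sym + AF_bare) CUTOFF-HALVING UNIVERSALITY with a running bare step.**  There is a bare step function
`Δ` bounded below by `d₀ > 0` at large `β` (the marginal coupling RUNS: `b₀ > 0`; for `U(1)₄` no such `Δ` exists —
the purity is `L`-independent but `β`-dependent) such that the purity at size `2L` and coupling `β + Δ(β)` agrees
with the purity at size `L` and coupling `β` up to `u(L) → 0`, uniformly in large `β`. [folklore] -/
def CutoffHalvingUniversality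
    (Δ : ℝ → ℝ) : Prop :=
  ∀ (G : Type) [Group G] [TopologicalSpace G] [IsTopologicalGroup G] [CompactSpace G]
    [MeasurableSpace G] [BorelSpace G],
    IsCompactSimpleLieGroup G → SimplyConnectedSpace G →
      ∀ (r : LatticeRep G), ∃ (u : ℕ → ℝ) (d₀ β₀ : ℝ) (L₀ : ℕ), 0 < d₀ ∧ Tendsto u atTop (𝓝 0) ∧
        ∀ β : ℝ, β₀ ≤ β → d₀ ≤ Δ β ∧ ∀ L : ℕ, L₀ ≤ L →
          |purity r (β + Δ β) (2 * L) - purity r β L| ≤ u L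

/-- **(CasimirActionDecrease) the purity strictly DECREASES in `β` across the bare step, inside the window.**
Equivalently (identity above) `∫_β^{β+Δ} D_b(2L) db/b ≥ θ'`: per plaquette, the action density on `(2L)³×4L`
exceeds that on `(2L)⁴` by `≳ 1/L⁴` — a LOWER bound on a Casimir-type effect with the sign "colder ⇒ more
action" (true wherever the low levels scale together: femto regime by the common running factor, massive regime by
`E_i − E_0 = a(β)M_i`; the crossover is the content). [folklore] -/
def CasimirActionDecrease (Δ : ℝ → ℝ) : Prop :=
  ∀ (G : Type) [Group G] [TopologicalSpace G] [IsTopologicalGroup G] [CompactSpace G]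
    [MeasurableSpace G] [BorelSpace G],
    IsCompactSimpleLieGroup G → SimplyConnectedSpace G →
      ∀ (r : LatticeRep G) (plo ε : ℝ), 0 < plo → 0 < ε →
        ∃ (θ' β₀ : ℝ) (L₀ : ℕ), 0 < θ' ∧
          ∀ β : ℝ, β₀ ≤ β → ∀ L : ℕ, L₀ ≤ L → plo ≤ purity r β L → purity r β L ≤ 1 - ε →
            purity r (β + Δ β) (2 * L) + θ' ≤ purity r β (2 * L)

/-- The β-form implies CROSS (bookkeeping, proved): `π_β(2L) ≥ π_{β+Δ}(2L) + θ' ≥ π_β(L) − u(L) + θ' ≥ π_β(L) + θ'/2`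
once `u(L) ≤ θ'/2`. [folklore] -/
theorem crossoverGrowth_of_betaForm (Δ : ℝ → ℝ) (hU : CutoffHalvingUniversality Δ)
    (hC : CasimirActionDecrease Δ) : CrossoverGrowth := by
  intro G _ _ _ _ _ _ hG hsc r plo ε hplo hε
  obtain ⟨u, d₀, β₀, L₀, hd₀, hu, hmatch⟩ := hU G hG hsc r
  obtain ⟨θ', β₀', L₀', hθ', hdec⟩ := hC G hG hsc r plo ε hplo hε
  obtain ⟨L₁, hL₁⟩ := eventually_atTop.1 (hu.eventually (eventually_lt_nhds (half_pos hθ')))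
  refine ⟨θ' / 2, max β₀ β₀', max L₁ (max L₀ L₀'), half_pos hθ', fun β hβ L hL hlo hhi => ?_⟩
  have hββ₀ : β₀ ≤ β := (le_max_left _ _).trans hβ
  have hββ₀' : β₀' ≤ β := (le_max_right _ _).trans hβ
  have hLL₁ : L₁ ≤ L := (le_max_left _ _).trans hL
  have hLL₀ : L₀ ≤ L := ((le_max_left _ _).trans (le_max_right _ _)).trans hL
  have hLL₀' : L₀' ≤ L := ((le_max_right _ _).trans (le_max_right _ _)).trans hL
  have h1 := (hmatch β hββ₀).2 L hLL₀
  have h2 := hdec β hββ₀' L hLL₀' hlo hhi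
  have h3 := hL₁ L hLL₁
  have h4 := (abs_le.1 h1).1
  linarith

/-! ## Where the line lands (statements only; the shared items are referenced BY NAME)

`MonotoneExit ∧ DoublingDefect.DoublingRecursion → DoublingDefect.OneTorusExit` (iterate the recursion
from an exit with `ε ≤ 1/(2C)`), then `DoublingDefect.RecursionToGap` (stmt-QuantumFields-17755) gives
the volume-uniform gap `m(β) ≥ c/L*(β)` for all local observables, and `L*(β) → ∞` by clause (ii).  For W₁
in its R2-LOCAL form (`Strategist.OneScaleRPCoreLoc`, the repaired kernel of this crux) the tracking
scheme is `b_j := β₀ + j`, `μ_j := c/L*(b_j)`; the thermal constant is DoublingDefect's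
`Tr T^P/λ₀^P − 1 ≤ δ/(1−δ)`, and the one-scale clauses at scale `L*` come from RP log-convexity of the
plaquette two-point function plus a certified perturbative window reaching `L*/K₀`
(XiCompleteMonotonicity's AxialLogConvexity / ExponentialWindow; TunedSequenceExists' fixed-aspect-window). -/

/-- The growth half feeds DoublingDefect's exit (statement; the proof iterates the recursion). [folklore] -/
def ExitFromMonotoneExit : Prop :=
  MonotoneExit → Summit.QuantumFields.YangMills.Theses.DoublingDefect.DoublingRecursion →
    Summit.QuantumFields.YangMills.Theses.DoublingDefect.OneTorusExit

end Summit.QuantumFields.YangMills.Cruxes.GapAtCorrelationLength.StepScaling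

end
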